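import Literature.Topology.FourManifolds.TautFoliationsSuspensionCollar
import HarnessLib

/-!
# Fences over leaf paths with prescribed end verticals

Topic: codimension-one `C⁰` foliations, fences (`TautFoliationsFences.lean`), sequel to
`TautFoliationsSuspensionCollar.lean` (the loop case). Let `F` be transversely oriented,
`ℓ : x₀ ⟶ x₁` a path of `M` continuous in the leaf topology (a leafwise path) and `e₀ ∋ x₀`,
`e₁ ∋ x₁` flow boxes of the atlas, `τ₀ = h_{e₀}(x₀)`, `t₁ = h_{e₁}(x₁)`. **There is a fence `Φ` over
the whole parameter interval for the lift `Γ` of `ℓ` to the germ space starting at the germ of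
`h_{e₀}`, whose end verticals run on the verticals of `e₀` through `x₀` and of `e₁` through `x₁`**:
`Φ 0 τ = e₀.symm ((e₀ x₀).1, τ)` and `Φ 1 τ = e₁.symm ((e₁ x₁).1, ψ₁ τ)`, where `ψ₁` — the holonomy
of the path read from levels to `e₁`-heights — is continuous and strictly increasing on the level
interval with `ψ₁ τ₀ = t₁`, inverse to the increasing homeomorphism germ `φ₁` with
`(Γ 1).germ = germ (φ₁ ∘ h_{e₁})` (`IsTransverselyOriented.exists_pathFence`). The proof is that
of the loop case: local data at the two ends in the boxes `e₀`, `e₁` (the germ of `Γ` near `1` read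
in `e₁` is increasing by `isIncr_continuation`-type transport, `GermSpace.IsIncr.of_path`), an
explicit initial fence near the ends, and the relative existence theorem
`exists_isFenceOn_univ_of_isFenceOn`. This is the "long flow box" along an arc of leaf
(Camacho–Lins Neto, Ch. IV §2 Thm. 2, relative form), used to follow the leaves near a
separatrix between the local models at its two end points.

* `Foliation.leafPath` (**definition**): a leafwise path as a path of the leaf space;
* `IsTransverselyOriented.exists_pathFence` (**proved**; from any increasing initial germ `d₀`, e.g.
  `GermSpace.ofHeight`, with both end verticals prescribed in boxes of the atlas).

## References

* C. Camacho, A. Lins Neto, *Geometric Theory of Foliations*, Birkhäuser (1985), Ch. IV §2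
  Thm. 2 [CamachoLinsNeto1985].
-/

open Set Filter Function Topology unitInterval

namespace Literature.Topology.FourManifolds

namespace Foliation

variable {B : Type*} [NormedAddCommGroup B] {M : Type*} [TopologicalSpace M] (F : Foliation B M)
variable {x₀ x₁ : M} {e₀ e₁ : OpenPartialHomeomorph M (B × ℝ)}

/-! ## Leafwise paths as paths of the leaf space -/

/-- A path of `M` continuous in the leaf topology, as a path of the leaf space `M^δ`. [folklore] -/
def leafPath (ℓ : Path x₀ x₁) (hℓ : Continuous (toLeafSpace ∘ ℓ : I → F.LeafSpace)) :
    Path (toLeafSpace x₀ : F.LeafSpace) (toLeafSpace x₁) where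
  toFun := toLeafSpace ∘ ℓ
  continuous_toFun := hℓ
  source' := by simp
  target' := by simp

/-- The points of the leaf path are those of the path. [folklore] -/
@[simp] theorem ofLeafSpace_leafPath (ℓ : Path x₀ x₁) (hℓ : Continuous (toLeafSpace ∘ ℓ : I → F.LeafSpace))
    (θ : I) : ofLeafSpace (F.leafPath ℓ hℓ θ) = ℓ θ := rfl

/-! ## The fence over a leaf path -/

variable {F} in
/-- **Fence over a leafwise path with prescribed end verticals, from an increasing initial
germ.** Let `d₀` be an increasing distinguished germ (e.g. the germ of `h_{e₀}`, or any germ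
reached by continuation from such a germ), `ℓ` a leafwise path starting at its base point
`x₀ = pt d₀` and ending at `x₁`, and `e₀ ∋ x₀`, `e₁ ∋ x₁` flow boxes of the atlas. Then the lift
`Γ` of `ℓ` starting at `d₀` carries a fence `Φ` over the whole parameter interval, at the level
`τ₀` of `d₀`, whose end verticals run on the verticals of `e₀` through `x₀` and of `e₁` through
`x₁`: `Φ 0 τ = e₀.symm ((e₀ x₀).1, ψ₀ τ)`, `Φ 1 τ = e₁.symm ((e₁ x₁).1, ψ₁ τ)`, where for
`i = 0, 1`, `φᵢ` is an increasing homeomorphism germ at `tᵢ = h_{eᵢ}(xᵢ)` with `φᵢ tᵢ = τ₀` and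
`(Γ i).germ = germ (φᵢ ∘ h_{eᵢ})`, and `ψᵢ` is its inverse: continuous and strictly increasing on
the level interval, `ψᵢ τ₀ = tᵢ`, `φᵢ (ψᵢ τ) = τ` there and `ψᵢ ∘ φᵢ = id` near `tᵢ`.
[cite: CamachoLinsNeto1985, Ch. IV §2 Thm. 2] -/
theorem IsTransverselyOriented.exists_pathFence [NormedSpace ℝ B] [Nonempty B] [LocallyConnectedSpace B]
    (ho : F.IsTransverselyOriented) (d₀ : F.GermSpace) (hd₀ : GermSpace.IsIncr d₀)
    (ℓ : Path (ofLeafSpace d₀.pt) x₁) (hℓ : Continuous (toLeafSpace ∘ ℓ : I → F.LeafSpace))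
    (he₀ : e₀ ∈ F.atlas) (hx₀ : ofLeafSpace d₀.pt ∈ e₀.source) (he₁ : e₁ ∈ F.atlas) (hx₁ : x₁ ∈ e₁.source) :
    ∃ (ε : ℝ) (φ₀ ψ₀ φ₁ ψ₁ : ℝ → ℝ) (Γ : C(I, F.GermSpace)) (Φ : I → ℝ → M), 0 < ε ∧
      IsIncrHomeoGermAt φ₀ (e₀ (ofLeafSpace d₀.pt)).2 ∧ φ₀ (e₀ (ofLeafSpace d₀.pt)).2 = GermSpace.level d₀ ∧
      ContinuousOn ψ₀ (Ioo (GermSpace.level d₀ - ε) (GermSpace.level d₀ + ε)) ∧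
      StrictMonoOn ψ₀ (Ioo (GermSpace.level d₀ - ε) (GermSpace.level d₀ + ε)) ∧
      ψ₀ (GermSpace.level d₀) = (e₀ (ofLeafSpace d₀.pt)).2 ∧
      (∀ τ ∈ Ioo (GermSpace.level d₀ - ε) (GermSpace.level d₀ + ε), φ₀ (ψ₀ τ) = τ) ∧
      (ψ₀ ∘ φ₀ =ᶠ[𝓝 (e₀ (ofLeafSpace d₀.pt)).2] id) ∧
      IsIncrHomeoGermAt φ₁ (e₁ x₁).2 ∧ φ₁ (e₁ x₁).2 = GermSpace.level d₀ ∧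
      ContinuousOn ψ₁ (Ioo (GermSpace.level d₀ - ε) (GermSpace.level d₀ + ε)) ∧
      StrictMonoOn ψ₁ (Ioo (GermSpace.level d₀ - ε) (GermSpace.level d₀ + ε)) ∧ ψ₁ (GermSpace.level d₀) = (e₁ x₁).2 ∧
      (∀ τ ∈ Ioo (GermSpace.level d₀ - ε) (GermSpace.level d₀ + ε), φ₁ (ψ₁ τ) = τ) ∧ (ψ₁ ∘ φ₁ =ᶠ[𝓝 (e₁ x₁).2] id) ∧
      GermSpace.proj ∘ Γ = F.leafPath ℓ hℓ ∧ Γ 0 = d₀ ∧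
      d₀.germ = ↑(φ₀ ∘ height e₀) ∧ (Γ 1).germ = ↑(φ₁ ∘ height e₁) ∧
      IsFenceOn F Γ (GermSpace.level d₀) ε Φ univ ∧
      (∀ τ ∈ Ioo (GermSpace.level d₀ - ε) (GermSpace.level d₀ + ε), Φ 0 τ = e₀.symm ((e₀ (ofLeafSpace d₀.pt)).1, ψ₀ τ)) ∧
      (∀ τ ∈ Ioo (GermSpace.level d₀ - ε) (GermSpace.level d₀ + ε), Φ 1 τ = e₁.symm ((e₁ x₁).1, ψ₁ τ)) := by
  set τ₀ : ℝ := GermSpace.level d₀ with hτ₀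
  set t₀ : ℝ := (e₀ (ofLeafSpace d₀.pt)).2 with ht₀def
  set t₁ : ℝ := (e₁ x₁).2 with ht₁def
  set L := F.leafPath ℓ hℓ with hL
  -- the lift of the path to the germ space
  have hL0 : L 0 = GermSpace.proj d₀ := L.source
  set Γ : C(I, F.GermSpace) := (F.isCoveringMap_proj).liftPath L d₀ hL0 with hΓ
  have hΓlift : GermSpace.proj ∘ Γ = L := (F.isCoveringMap_proj).liftPath_lifts L d₀ hL0
  have hΓ0 : Γ 0 = d₀ := (F.isCoveringMap_proj).liftPath_zero L d₀ hL0
  have hΓpt : ∀ θ, ofLeafSpace (Γ θ).pt = ℓ θ := fun θ ↦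
    congrArg ofLeafSpace (congr_fun hΓlift θ)
  have hlev : ∀ θ, GermSpace.level (Γ θ) = τ₀ := fun θ ↦ by
    rw [GermSpace.level_apply_eq_of_path Γ θ 0, hΓ0]
  -- the germs of `Γ 0 = d₀` and `Γ 1`, read in `e₀`, `e₁`, are increasing
  have hsrc0 : ofLeafSpace (Γ 0).pt ∈ e₀.source := by rw [hΓpt, ℓ.source]; exact hx₀
  have hsrc1 : ofLeafSpace (Γ 1).pt ∈ e₁.source := by rw [hΓpt, ℓ.target]; exact hx₁
  have hincr0 : GermSpace.IsIncr (Γ 0) := by rw [hΓ0]; exact hd₀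
  have hincr1 : GermSpace.IsIncr (Γ 1) := GermSpace.IsIncr.of_path ho Γ hincr0 1
  obtain ⟨φ₀, hφ₀, hgerm0⟩ := hincr0.exists_eq ho he₀ hsrc0
  obtain ⟨φ₁, hφ₁, hgerm1⟩ := hincr1.exists_eq ho he₁ hsrc1
  have ht₀ : (e₀ (ofLeafSpace (Γ 0).pt)).2 = t₀ := by rw [hΓpt, ℓ.source]
  have ht₁ : (e₁ (ofLeafSpace (Γ 1).pt)).2 = t₁ := by rw [hΓpt, ℓ.target]
  rw [ht₀] at hφ₀
  rw [ht₁] at hφ₁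
  have hφ₀t₀ : φ₀ t₀ = τ₀ := by
    have h := hlev 0
    unfold GermSpace.level at h
    rw [hgerm0, Germ.value_ofFun, comp_apply, height_apply, ht₀] at h
    exact h
  have hφ₁t₁ : φ₁ t₁ = τ₀ := by
    have h := hlev 1
    unfold GermSpace.level at h
    rw [hgerm1, Germ.value_ofFun, comp_apply, height_apply, ht₁] at h
    exact h
  obtain ⟨ψ₀, hψ₀, hψ₀τ₀, hψφ₀, hφψ₀⟩ := hφ₀.exists_inverse
  rw [hφ₀t₀] at hψ₀ hψ₀τ₀ hφψ₀
  obtain ⟨ψ₁, hψ₁, hψ₁τ₀, hψφ₁, hφψ₁⟩ := hφ₁.exists_inverse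
  rw [hφ₁t₁] at hψ₁ hψ₁τ₀ hφψ₁
  -- local descriptions of `Γ` near `0` (box `e₀`) and near `1` (box `e₁`)
  obtain ⟨χ₀, hχ₀, U₀, hU₀, H₀⟩ := F.exists_nhds_forall_eq_germSection Γ 0 he₀ hsrc0
  obtain ⟨χ₁, hχ₁, U₁, hU₁, H₁⟩ := F.exists_nhds_forall_eq_germSection Γ 1 he₁ hsrc1
  generalize (e₀ (ofLeafSpace (Γ 0).pt)).2 = t at hχ₀ H₀ ht₀
  subst ht₀
  generalize (e₁ (ofLeafSpace (Γ 1).pt)).2 = t at hχ₁ H₁ ht₁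
  subst ht₁
  -- `χ₀ = φ₀` near `t₀` and `χ₁ = φ₁` near `t₁`
  have hχ₀φ : χ₀ =ᶠ[𝓝 t₀] φ₀ := by
    obtain ⟨-, hG0⟩ := H₀ 0 (mem_of_mem_nhds hU₀)
    have h1 : (Γ 0).germ = ↑(χ₀ ∘ height e₀) := by rw [hG0, germSection_germ]
    rw [hgerm0] at h1
    have := (F.eventuallyEq_of_comp_height_eq he₀ hsrc0 h1).symm
    rwa [hΓpt, ℓ.source] at this
  have hχ₁φ : χ₁ =ᶠ[𝓝 t₁] φ₁ := by
    obtain ⟨-, hG1⟩ := H₁ 1 (mem_of_mem_nhds hU₁)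
    have h1 : (Γ 1).germ = ↑(χ₁ ∘ height e₁) := by rw [hG1, germSection_germ]
    rw [hgerm1] at h1
    have := (F.eventuallyEq_of_comp_height_eq he₁ hsrc1 h1).symm
    rwa [hΓpt, ℓ.target] at this
  have hgerm_near0 : ∀ a ∈ U₀, ofLeafSpace (Γ a).pt ∈ plaque e₀ t₀ ∧ (Γ a).germ = ↑(φ₀ ∘ height e₀) := by
    intro a ha
    obtain ⟨hpl, hGa⟩ := H₀ a ha
    refine ⟨hpl, ?_⟩
    rw [hGa, germSection_germ, Germ.coe_eq]
    have hc : ContinuousAt (height e₀) (ofLeafSpace (F.leafPlaqueMap e₀ t₀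
        (e₀ (ofLeafSpace (Γ a).pt)).1)) := continuousAt_height (F.plaqueMap_mem_source he₀ _ _)
    have hval : height e₀ (ofLeafSpace (F.leafPlaqueMap e₀ t₀ (e₀ (ofLeafSpace (Γ a).pt)).1)) = t₀ := by
      rw [height_apply, ofLeafSpace_leafPlaqueMap, F.apply_plaqueMap he₀]
    rw [← hval] at hχ₀φ
    exact hc.tendsto.eventually hχ₀φ |>.mono fun y hy ↦ by simp only [comp_apply]; exact hy
  have hgerm_near1 : ∀ a ∈ U₁, ofLeafSpace (Γ a).pt ∈ plaque e₁ t₁ ∧ (Γ a).germ = ↑(φ₁ ∘ height e₁) := by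
    intro a ha
    obtain ⟨hpl, hGa⟩ := H₁ a ha
    refine ⟨hpl, ?_⟩
    rw [hGa, germSection_germ, Germ.coe_eq]
    have hc : ContinuousAt (height e₁) (ofLeafSpace (F.leafPlaqueMap e₁ t₁
        (e₁ (ofLeafSpace (Γ a).pt)).1)) := continuousAt_height (F.plaqueMap_mem_source he₁ _ _)
    have hval : height e₁ (ofLeafSpace (F.leafPlaqueMap e₁ t₁ (e₁ (ofLeafSpace (Γ a).pt)).1)) = t₁ := by
      rw [height_apply, ofLeafSpace_leafPlaqueMap, F.apply_plaqueMap he₁]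
    rw [← hval] at hχ₁φ
    exact hc.tendsto.eventually hχ₁φ |>.mono fun y hy ↦ by simp only [comp_apply]; exact hy
  -- a common radius `ε₀` for all the germ data
  obtain ⟨ρφ₀, hρφ₀, hφc₀, hφm₀⟩ := hφ₀
  obtain ⟨ρψ₀, hρψ₀, hψc₀, hψm₀⟩ := hψ₀
  obtain ⟨ρφ₁, hρφ₁, hφc₁, hφm₁⟩ := hφ₁
  obtain ⟨ρψ₁, hρψ₁, hψc₁, hψm₁⟩ := hψ₁
  obtain ⟨ρa₀, hρa₀, hρa₀sub⟩ := IsHomeoGermAt.exists_Ioo_subset_of_mem_nhds hφψ₀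
  obtain ⟨ρb₀, hρb₀, hρb₀sub⟩ := IsHomeoGermAt.exists_Ioo_subset_of_mem_nhds hψφ₀
  obtain ⟨ρa₁, hρa₁, hρa₁sub⟩ := IsHomeoGermAt.exists_Ioo_subset_of_mem_nhds hφψ₁
  obtain ⟨ρb₁, hρb₁, hρb₁sub⟩ := IsHomeoGermAt.exists_Ioo_subset_of_mem_nhds hψφ₁
  have hψca₀ : ContinuousAt ψ₀ τ₀ := hψc₀.continuousAt (IsHomeoGermAt.Ioo_mem_nhds_of_pos hρψ₀)
  have hψca₁ : ContinuousAt ψ₁ τ₀ := hψc₁.continuousAt (IsHomeoGermAt.Ioo_mem_nhds_of_pos hρψ₁)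
  have hbig₀ : Ioo (t₀ - min ρφ₀ ρb₀) (t₀ + min ρφ₀ ρb₀) ∈ 𝓝 t₀ := IsHomeoGermAt.Ioo_mem_nhds_of_pos (lt_min hρφ₀ hρb₀)
  have hbig₁ : Ioo (t₁ - min ρφ₁ ρb₁) (t₁ + min ρφ₁ ρb₁) ∈ 𝓝 t₁ := IsHomeoGermAt.Ioo_mem_nhds_of_pos (lt_min hρφ₁ hρb₁)
  obtain ⟨ε₀, hε₀, hε₀sub⟩ := IsHomeoGermAt.exists_Ioo_subset_of_mem_nhds (inter_mem
    (inter_mem (IsHomeoGermAt.Ioo_mem_nhds_of_pos (lt_min (lt_min hρψ₀ hρa₀) (lt_min hρψ₁ hρa₁)))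
      (hψca₀.preimage_mem_nhds (by rw [hψ₀τ₀]; exact hbig₀)))
    (hψca₁.preimage_mem_nhds (by rw [hψ₁τ₀]; exact hbig₁)))
  -- what holds on the small interval
  have hJ : ∀ τ ∈ Ioo (τ₀ - ε₀) (τ₀ + ε₀),
      (τ ∈ Ioo (τ₀ - ρψ₀) (τ₀ + ρψ₀) ∧ φ₀ (ψ₀ τ) = τ ∧ ψ₀ τ ∈ Ioo (t₀ - ρφ₀) (t₀ + ρφ₀) ∧ ψ₀ (φ₀ (ψ₀ τ)) = ψ₀ τ) ∧
      (τ ∈ Ioo (τ₀ - ρψ₁) (τ₀ + ρψ₁) ∧ φ₁ (ψ₁ τ) = τ ∧ ψ₁ τ ∈ Ioo (t₁ - ρφ₁) (t₁ + ρφ₁) ∧ ψ₁ (φ₁ (ψ₁ τ)) = ψ₁ τ) := by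
    intro τ hτ
    obtain ⟨⟨h₁, h₂⟩, h₃⟩ := hε₀sub hτ
    have a := min_le_left (min ρψ₀ ρa₀) (min ρψ₁ ρa₁)
    have b := min_le_right (min ρψ₀ ρa₀) (min ρψ₁ ρa₁)
    have a₁ := min_le_left ρψ₀ ρa₀
    have a₂ := min_le_right ρψ₀ ρa₀
    have b₁ := min_le_left ρψ₁ ρa₁
    have b₂ := min_le_right ρψ₁ ρa₁
    have hτψ₀ : τ ∈ Ioo (τ₀ - ρψ₀) (τ₀ + ρψ₀) := ⟨by linarith [h₁.1], by linarith [h₁.2]⟩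
    have hτa₀ : τ ∈ Ioo (τ₀ - ρa₀) (τ₀ + ρa₀) := ⟨by linarith [h₁.1], by linarith [h₁.2]⟩
    have hτψ₁ : τ ∈ Ioo (τ₀ - ρψ₁) (τ₀ + ρψ₁) := ⟨by linarith [h₁.1], by linarith [h₁.2]⟩
    have hτa₁ : τ ∈ Ioo (τ₀ - ρa₁) (τ₀ + ρa₁) := ⟨by linarith [h₁.1], by linarith [h₁.2]⟩
    have h₂' : ψ₀ τ ∈ Ioo (t₀ - min ρφ₀ ρb₀) (t₀ + min ρφ₀ ρb₀) := h₂
    have h₃' : ψ₁ τ ∈ Ioo (t₁ - min ρφ₁ ρb₁) (t₁ + min ρφ₁ ρb₁) := h₃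
    have c₁ := min_le_left ρφ₀ ρb₀
    have c₂ := min_le_right ρφ₀ ρb₀
    have d₁ := min_le_left ρφ₁ ρb₁
    have d₂ := min_le_right ρφ₁ ρb₁
    have hψφ₀' : ψ₀ τ ∈ Ioo (t₀ - ρφ₀) (t₀ + ρφ₀) := ⟨by linarith [h₂'.1], by linarith [h₂'.2]⟩
    have hψb₀ : ψ₀ τ ∈ Ioo (t₀ - ρb₀) (t₀ + ρb₀) := ⟨by linarith [h₂'.1], by linarith [h₂'.2]⟩
    have hψφ₁' : ψ₁ τ ∈ Ioo (t₁ - ρφ₁) (t₁ + ρφ₁) := ⟨by linarith [h₃'.1], by linarith [h₃'.2]⟩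
    have hψb₁ : ψ₁ τ ∈ Ioo (t₁ - ρb₁) (t₁ + ρb₁) := ⟨by linarith [h₃'.1], by linarith [h₃'.2]⟩
    exact ⟨⟨hτψ₀, hρa₀sub hτa₀, hψφ₀', hρb₀sub hψb₀⟩, ⟨hτψ₁, hρa₁sub hτa₁, hψφ₁', hρb₁sub hψb₁⟩⟩
  -- the two local data at the ends
  have htarget₀ : ∀ v : B × ℝ, v ∈ e₀.target := fun v ↦ by rw [F.target_eq e₀ he₀]; exact mem_univ _
  have htarget₁ : ∀ v : B × ℝ, v ∈ e₁.target := fun v ↦ by rw [F.target_eq e₁ he₁]; exact mem_univ _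
  let D₀ : LocalDatum F Γ τ₀ ε₀ U₀ :=
    { box := e₀
      box_mem := he₀
      φ := φ₀
      ψ := ψ₀
      germ_eq := fun a ha ↦ (hgerm_near0 a ha).2
      pt_mem := fun a ha ↦ by rw [hψ₀τ₀]; exact (hgerm_near0 a ha).1
      φ_ψ := fun τ hτ ↦ (hJ τ hτ).1.2.1
      ψ_φ := by
        rw [hψ₀τ₀]
        exact hψφ₀.mono fun r hr ↦ hr
      ψ_cont := hψc₀.mono fun τ hτ ↦ (hJ τ hτ).1.1
      ψ_inj := hψm₀.injOn.mono fun τ hτ ↦ (hJ τ hτ).1.1 }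
  let D₁ : LocalDatum F Γ τ₀ ε₀ U₁ :=
    { box := e₁
      box_mem := he₁
      φ := φ₁
      ψ := ψ₁
      germ_eq := fun a ha ↦ (hgerm_near1 a ha).2
      pt_mem := fun a ha ↦ by rw [hψ₁τ₀]; exact (hgerm_near1 a ha).1
      φ_ψ := fun τ hτ ↦ (hJ τ hτ).2.2.1
      ψ_φ := by
        rw [hψ₁τ₀]
        exact hψφ₁.mono fun r hr ↦ hr
      ψ_cont := hψc₁.mono fun τ hτ ↦ (hJ τ hτ).2.1
      ψ_inj := hψm₁.injOn.mono fun τ hτ ↦ (hJ τ hτ).2.1 }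
  -- disjoint open neighbourhoods of the ends inside `U₀`, `U₁`
  have hhalf : (1 / 2 : ℝ) ∈ I := ⟨by norm_num, by norm_num⟩
  set c : I := ⟨1 / 2, hhalf⟩ with hc
  have h0c : (0 : I) < c := Subtype.coe_lt_coe.1 (by rw [hc]; norm_num)
  have hc1 : c < 1 := Subtype.coe_lt_coe.1 (by rw [hc]; norm_num)
  obtain ⟨O₀, hO₀U, hO₀o, h0O₀⟩ := mem_nhds_iff.1 (inter_mem hU₀ ((isOpen_gt' c).mem_nhds h0c))
  obtain ⟨O₁, hO₁U, hO₁o, h1O₁⟩ := mem_nhds_iff.1 (inter_mem hU₁ ((isOpen_lt' c).mem_nhds hc1))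
  -- the initial fence over `O₀ ∪ O₁`
  classical
  set Φ₀ : I → ℝ → M := fun a τ ↦
    if a < c then e₀.symm ((e₀ (ℓ a)).1, ψ₀ τ) else e₁.symm ((e₁ (ℓ a)).1, ψ₁ τ) with hΦ₀
  have hO₀lt : ∀ a ∈ O₀, a < c := fun a ha ↦ (hO₀U ha).2
  have hO₁gt : ∀ a ∈ O₁, ¬ a < c := fun a ha ↦ not_lt.2 (le_of_lt (hO₁U ha).2)
  have hΦ₀O₀ : ∀ a ∈ O₀, ∀ τ, Φ₀ a τ = e₀.symm ((e₀ (ℓ a)).1, ψ₀ τ) := fun a ha τ ↦ by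
    simp only [hΦ₀, if_pos (hO₀lt a ha)]
  have hΦ₀O₁ : ∀ a ∈ O₁, ∀ τ, Φ₀ a τ = e₁.symm ((e₁ (ℓ a)).1, ψ₁ τ) := fun a ha τ ↦ by
    simp only [hΦ₀, if_neg (hO₁gt a ha)]
  have hpl0 : ∀ a ∈ O₀, ℓ a ∈ plaque e₀ t₀ := fun a ha ↦ by
    rw [← hΓpt]; exact (hgerm_near0 a (hO₀U ha).1).1
  have hpl1 : ∀ a ∈ O₁, ℓ a ∈ plaque e₁ t₁ := fun a ha ↦ by
    rw [← hΓpt]; exact (hgerm_near1 a (hO₁U ha).1).1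
  have hfence₀ : IsFenceOn F Γ τ₀ ε₀ Φ₀ (O₀ ∪ O₁) := by
    refine ⟨?_, ?_, ?_⟩
    · have hc0 : ContinuousOn (uncurry Φ₀) (O₀ ×ˢ Ioo (τ₀ - ε₀) (τ₀ + ε₀)) := by
        have : ContinuousOn (fun q : I × ℝ ↦ e₀.symm ((e₀ (ℓ q.1)).1, ψ₀ q.2))
            (O₀ ×ˢ Ioo (τ₀ - ε₀) (τ₀ + ε₀)) := by
          refine (F.continuous_symm_of_mem he₀).comp_continuousOn (ContinuousOn.prodMk ?_ ?_)
          · refine continuous_fst.comp_continuousOn (e₀.continuousOn.comp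
              (ℓ.continuous.comp_continuousOn continuousOn_fst) fun q hq ↦ (hpl0 q.1 hq.1).1)
          · exact hψc₀.comp continuousOn_snd fun q hq ↦ (hJ q.2 hq.2).1.1
        exact this.congr fun q hq ↦ hΦ₀O₀ q.1 hq.1 q.2
      have hc1 : ContinuousOn (uncurry Φ₀) (O₁ ×ˢ Ioo (τ₀ - ε₀) (τ₀ + ε₀)) := by
        have : ContinuousOn (fun q : I × ℝ ↦ e₁.symm ((e₁ (ℓ q.1)).1, ψ₁ q.2))
            (O₁ ×ˢ Ioo (τ₀ - ε₀) (τ₀ + ε₀)) := by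
          refine (F.continuous_symm_of_mem he₁).comp_continuousOn (ContinuousOn.prodMk ?_ ?_)
          · refine continuous_fst.comp_continuousOn (e₁.continuousOn.comp
              (ℓ.continuous.comp_continuousOn continuousOn_fst) fun q hq ↦ (hpl1 q.1 hq.1).1)
          · exact hψc₁.comp continuousOn_snd fun q hq ↦ (hJ q.2 hq.2).2.1
        exact this.congr fun q hq ↦ hΦ₀O₁ q.1 hq.1 q.2
      rw [union_prod]
      exact hc0.union_of_isOpen hc1 (hO₀o.prod isOpen_Ioo) (hO₁o.prod isOpen_Ioo)
    · rintro a (ha | ha)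
      · rw [hΦ₀O₀ a ha, hψ₀τ₀, hΓpt]
        have h := hpl0 a ha
        conv_lhs => rw [← h.2, show ((e₀ (ℓ a)).1, (e₀ (ℓ a)).2) = e₀ (ℓ a) from rfl]
        exact e₀.left_inv h.1
      · rw [hΦ₀O₁ a ha, hψ₁τ₀, hΓpt]
        have h := hpl1 a ha
        conv_lhs => rw [← h.2, show ((e₁ (ℓ a)).1, (e₁ (ℓ a)).2) = e₁ (ℓ a) from rfl]
        exact e₁.left_inv h.1
    · rintro a (ha | ha)
      · refine ⟨O₀, hO₀o.mem_nhds ha, D₀.restrict (fun a' ha' ↦ (hO₀U ha'.1).1) le_rfl, ?_⟩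
        rintro a' ⟨ha', -⟩ τ hτ
        rw [hΦ₀O₀ a' ha']
        refine ⟨e₀.map_target (htarget₀ _), ?_⟩
        rw [LocalDatum.restrict_ψ, height_apply, LocalDatum.restrict_box, e₀.right_inv (htarget₀ _)]
      · refine ⟨O₁, hO₁o.mem_nhds ha, D₁.restrict (fun a' ha' ↦ (hO₁U ha'.1).1) le_rfl, ?_⟩
        rintro a' ⟨ha', -⟩ τ hτ
        rw [hΦ₀O₁ a' ha']
        refine ⟨e₁.map_target (htarget₁ _), ?_⟩
        rw [LocalDatum.restrict_ψ, height_apply, LocalDatum.restrict_box, e₁.right_inv (htarget₁ _)]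
  -- extend to a fence over the whole interval, unchanged near the ends
  have hK : IsCompact ({0, 1} : Set I) := (Set.toFinite _).isCompact
  have hKS : ({0, 1} : Set I) ⊆ O₀ ∪ O₁ := by
    rintro a (rfl | rfl)
    exacts [Or.inl h0O₀, Or.inr h1O₁]
  obtain ⟨ε₁, hε₁, Φ, hΦ, V, -, hKV, hagree⟩ := F.exists_isFenceOn_univ_of_isFenceOn Γ hlev hε₀
    hfence₀ (hO₀o.union hO₁o) hK hKS
  -- the final radius
  set ε : ℝ := min ε₀ ε₁ with hεdef
  have hε : 0 < ε := lt_min hε₀ hε₁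
  have hεsub₀ : Ioo (τ₀ - ε) (τ₀ + ε) ⊆ Ioo (τ₀ - ε₀) (τ₀ + ε₀) :=
    Ioo_subset_Ioo (by rw [hεdef]; linarith [min_le_left ε₀ ε₁]) (by rw [hεdef]; linarith [min_le_left ε₀ ε₁])
  have hεsub₁ : Ioo (τ₀ - ε) (τ₀ + ε) ⊆ Ioo (τ₀ - ε₁) (τ₀ + ε₁) :=
    Ioo_subset_Ioo (by rw [hεdef]; linarith [min_le_right ε₀ ε₁]) (by rw [hεdef]; linarith [min_le_right ε₀ ε₁])
  refine ⟨ε, φ₀, ψ₀, φ₁, ψ₁, Γ, Φ, hε,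
    ⟨ρφ₀, hρφ₀, hφc₀, hφm₀⟩, hφ₀t₀, hψc₀.mono fun τ hτ ↦ (hJ τ (hεsub₀ hτ)).1.1,
    hψm₀.mono fun τ hτ ↦ (hJ τ (hεsub₀ hτ)).1.1, hψ₀τ₀, fun τ hτ ↦ (hJ τ (hεsub₀ hτ)).1.2.1, hψφ₀,
    ⟨ρφ₁, hρφ₁, hφc₁, hφm₁⟩, hφ₁t₁, hψc₁.mono fun τ hτ ↦ (hJ τ (hεsub₀ hτ)).2.1,
    hψm₁.mono fun τ hτ ↦ (hJ τ (hεsub₀ hτ)).2.1, hψ₁τ₀, fun τ hτ ↦ (hJ τ (hεsub₀ hτ)).2.2.1, hψφ₁, hΓlift, hΓ0,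
    ?_, hgerm1, hΦ.mono (subset_univ _) (min_le_right _ _), fun τ hτ ↦ ?_, fun τ hτ ↦ ?_⟩
  · rw [← hΓ0]; exact hgerm0
  · rw [hagree 0 (hKV (Or.inl rfl)) τ (hεsub₁ hτ), hΦ₀O₀ 0 h0O₀, ℓ.source]
  · rw [hagree 1 (hKV (Or.inr rfl)) τ (hεsub₁ hτ), hΦ₀O₁ 1 h1O₁, ℓ.target]

end Foliation

end Literature.Topology.FourManifolds
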